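import Summits.Ventures.Crystal3D.StickySpheres.RadiusOne
import Mathlib.Data.Finset.Sort
import HarnessLib

/-!
# No five mutually touching balls (the `K₅` filter) in the cell's diameter-`1` vocabulary

HONEST FRAMING. Part of the venture `Summits/Ventures/Crystal3D` (cell `pub-crystal3d`, PLAN R15
addendum (ii): every graph filter used by the enumeration engines must be a proved lemma). The
tree proves `Literature.Barriers.AtomisticToContinuum.no_five_pairwise_dist_two` (no five points
of `ℝ³` pairwise at distance `2`); this file transports it through the scaling bridge of
`StickySpheres/RadiusOne.lean`: a contact graph of diameter-`1` balls has no `K₅`. Nothing else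
is claimed.
-/

noncomputable section

open Finset

namespace Summit.Ventures.Crystal3D

open Literature.Barriers.AtomisticToContinuum (no_five_pairwise_dist_two)

variable {N : ℕ}

/-- **No five pairwise touching balls**: five centres of `ℝ³` cannot be pairwise at distance `1`
(labelled form: any `f : Fin 5 → Fin N` picking pairwise-touching balls is contradictory). -/
theorem no_five_pairwise_contacts (x : Fin N → EuclideanSpace ℝ (Fin 3)) (f : Fin 5 → Fin N)
    (h : ∀ a b : Fin 5, a ≠ b → dist (x (f a)) (x (f b)) = 1) : False :=
  no_five_pairwise_dist_two (fun a => (2 : ℝ) • x (f a)) fun a b hab => by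
    rw [dist_two_smul, h a b hab]; norm_num

/-- **The `K₅` filter**: no `5`-element set of labels is a clique of the contact graph. -/
theorem no_contact_clique_five (x : Fin N → EuclideanSpace ℝ (Fin 3)) (s : Finset (Fin N))
    (hs : s.card = 5) (h : ∀ i ∈ s, ∀ j ∈ s, i ≠ j → dist (x i) (x j) = 1) : False :=
  no_five_pairwise_contacts x (s.orderEmbOfFin hs) fun a b hab =>
    h _ (s.orderEmbOfFin_mem hs a) _ (s.orderEmbOfFin_mem hs b)
      fun hfe => hab ((s.orderEmbOfFin hs).injective hfe)

/-- Equivalently: among any five distinct balls of a configuration, two do not touch (the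
contact graph has clique number at most `4`, attained by the regular tetrahedron). -/
theorem exists_not_touching_of_five (x : Fin N → EuclideanSpace ℝ (Fin 3)) (f : Fin 5 → Fin N) :
    ∃ a b : Fin 5, a ≠ b ∧ dist (x (f a)) (x (f b)) ≠ 1 := by
  by_contra hcon
  refine no_five_pairwise_contacts x f fun a b hab => ?_
  by_contra hd
  exact hcon ⟨a, b, hab, hd⟩

end Summit.Ventures.Crystal3D

end
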